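import Summits.NavierStokesRegularity.NavierStokesRegularity.Theorems.ExtremiserTransienceNearExtremalTransienceExtremiserLiouvilleConstantSpeedExample
import Summits.NavierStokesRegularity.NavierStokesRegularity.Theorems.ExtremiserTransienceNearExtremalTransienceExtremiserLiouvilleConstantSpeedL2Liouville
import HarnessLib

/-!
# Crux `ExtremiserTransience.NearExtremalTransience` (stmt-NavierStokesRegularity-21883), line `extremiser_liouville`,
# stub K1b — THE EXPLICIT CONSTANT-SPEED FIELD (2/2): far field, infinite L² excess, packaged statement

`--supports stmt-NavierStokesRegularity-21883` (helper).  Author: prover seat `ns-el-k1b` (g4).  Sequel of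
`…ConstantSpeedExample` (the field `v = fc·(x₀,x₁,0) + gc·(−x₁,x₀,0) + (1 + hc)·e₃`, `‖v‖ ≡ 1`, `div v = 0`, real
analytic, not constant).

* `norm_sub_sq`: **`‖v(x) − e₃‖² = 2 u b / Q³`** (`u = x₀² + x₁²`, `b = x₂² + 1`, `Q = ‖x‖² + 1`; this is `−2 hc`, the
  constant-speed relation `2⟪e₃, v − e₃⟫ = −‖v − e₃‖²`), `norm_sub_sq_le`: `≤ 2/(‖x‖² + 1)` — the deviation is
  `O(|x|⁻¹)` and swirl-dominated (`v_φ ≈ √(2b)·r/Q^{3/2}`);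
* `tendsto_field_cocompact`: **`v → e₃` at infinity** (the far field of K1b's residue object, `‖c‖ = M = 1`);
* `not_integrable_norm_sub_sq`: **`‖v − e₃‖² ∉ L¹(ℝ³)`** — by this line's L² flux Liouville
  `eq_farField_of_constSpeed_of_sq_integrable_axial` (a `C¹` divergence-free constant-speed field with square-integrable
  deviation from `e₃` IS `e₃`), since `v` is not constant.  (Directly: `2ub/Q³ ~ 2 sin²θ cos²θ·|x|⁻²` is not integrable at
  infinity.)
* `exists_constantSpeed_divFree_analytic_nonconstant`: the packaged existence statement in the vocabulary of K1b.

MEANING FOR K1b.  The residue of K1b after g2/g3 is «no constant-speed analytic extended extremiser», and the L² flux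
Liouville closes it for objects with `w − c ∈ L²`.  This example shows that NOTHING SHORT OF THE EXTREMALITY can close the
rest: constant speed + divergence free + real analytic + far field (+ finite Dirichlet energy, `‖Dv‖ ≤ 2/Q` — numerically,
not formalised here) is a consistent, non-rigid set of conditions, realised with exactly the borderline `|x|⁻¹` (non-L²)
tail.  The remaining Lean-sized gap (N0') `MemLp (w − c) 2` must therefore come from the KKT / Euler–Lagrange system of the
extremiser (records `Cruxes/NearExtremalTransience/Lines/extremiser_liouville_k1b_{plateau,multiplier}.md`).

WHAT THIS IS NOT: not a counterexample to K1b (the field is not extremal: its stretching `S = ∫⟪ω, Dv ω⟫` vanishes by the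
anti-symmetry under the rotation by `π` about the `x₀`-axis); K1b is NOT proved; nothing here proves NS regularity. [folklore]
-/

noncomputable section

open Set Filter Topology MeasureTheory Metric Function
open scoped ENNReal NNReal Topology InnerProductSpace RealInnerProductSpace ContDiff
open Literature.Analysis.FluidPDE Literature.Analysis

namespace Summit.NavierStokesRegularity.NavierStokesRegularity.Theorems

-- the problem directory repeats the summit name (`NavierStokesRegularity/NavierStokesRegularity`)
set_option linter.dupNamespace false

namespace ExtremiserLiouville

namespace ConstantSpeedExample


/-! ## Far field, non-square-integrability, packaged statement -/

/-- `Q = ‖x‖² + 1`. [folklore] -/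
theorem QQ_eq_norm_sq_add_one (x : EuclideanSpace ℝ (Fin 3)) : QQ x = ‖x‖ ^ 2 + 1 := by
  rw [EuclideanSpace.norm_eq, Real.sq_sqrt (Finset.sum_nonneg fun i _ => sq_nonneg _)]
  simp only [Fin.sum_univ_three, Real.norm_eq_abs, sq_abs, QQ, uu, bb]
  ring

/-- **The deviation from the far field**: `‖v(x) − e₃‖² = 2 u b / Q³` (`= −2 hc`, the constant-speed relation
`2⟪e₃, v − e₃⟫ = −‖v − e₃‖²`). [folklore] -/
theorem norm_sub_sq (x : EuclideanSpace ℝ (Fin 3)) :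
    ‖field x - EuclideanSpace.single (2 : Fin 3) (1 : ℝ)‖ ^ 2 = 2 * uu x * bb x / QQ x ^ 3 := by
  have hQ := QQ_ne_zero x
  -- the scalar identity `u fc² + u gc² + hc² = −2 hc = 2ub/Q³` from the speed budget
  have key : uu x * fc x ^ 2 + uu x * gc x ^ 2 + hc x ^ 2 = -2 * hc x := by
    linear_combination speed_budget x
  have key' : -2 * hc x = 2 * uu x * bb x / QQ x ^ 3 := by rw [hc]; ring
  rw [key'] at key
  simp only [uu] at key ⊢
  rw [EuclideanSpace.norm_eq, Real.sq_sqrt (Finset.sum_nonneg fun i _ => sq_nonneg _)]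
  simp only [Fin.sum_univ_three, Real.norm_eq_abs, sq_abs, PiLp.sub_apply, field_apply_zero, field_apply_one,
    field_apply_two, PiLp.single_apply]
  simp
  linear_combination key

/-- `‖v(x) − e₃‖² ≤ 2/(‖x‖² + 1)`: the deviation is `O(|x|⁻¹)` (swirl-dominated tail). [folklore] -/
theorem norm_sub_sq_le (x : EuclideanSpace ℝ (Fin 3)) :
    ‖field x - EuclideanSpace.single (2 : Fin 3) (1 : ℝ)‖ ^ 2 ≤ 2 / (‖x‖ ^ 2 + 1) := by
  rw [norm_sub_sq, ← QQ_eq_norm_sq_add_one]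
  have hQ := QQ_pos x
  have hu := uu_nonneg x
  have hb := one_le_bb x
  have hQdef : QQ x = uu x + bb x := rfl
  rw [div_le_div_iff₀ (pow_pos hQ 3) hQ]
  have : uu x * bb x ≤ QQ x ^ 2 := by rw [hQdef]; nlinarith [sq_nonneg (uu x - bb x)]
  nlinarith [this, hQ]

/-- **Far field**: `v(x) → e₃` as `|x| → ∞`. [folklore] -/
theorem tendsto_field_cocompact :
    Tendsto field (cocompact (EuclideanSpace ℝ (Fin 3))) (𝓝 (EuclideanSpace.single (2 : Fin 3) (1 : ℝ))) := by
  rw [tendsto_iff_norm_sub_tendsto_zero]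
  have h2 : Tendsto (fun x : EuclideanSpace ℝ (Fin 3) => 2 / (‖x‖ ^ 2 + 1)) (cocompact (EuclideanSpace ℝ (Fin 3))) (𝓝 0) := by
    have h1 : Tendsto (fun x : EuclideanSpace ℝ (Fin 3) => ‖x‖ ^ 2 + 1) (cocompact (EuclideanSpace ℝ (Fin 3))) atTop :=
      tendsto_atTop_add_const_right _ 1 ((tendsto_pow_atTop two_ne_zero).comp tendsto_norm_cocompact_atTop)
    simpa [div_eq_mul_inv] using h1.inv_tendsto_atTop.const_mul 2
  have hsq : Tendsto (fun x : EuclideanSpace ℝ (Fin 3) => ‖field x - EuclideanSpace.single (2 : Fin 3) (1 : ℝ)‖ ^ 2) (cocompact (EuclideanSpace ℝ (Fin 3))) (𝓝 0) :=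
    squeeze_zero (fun x => sq_nonneg _) norm_sub_sq_le h2
  have := hsq.sqrt
  simpa [Real.sqrt_sq (norm_nonneg _)] using this

/-- **The deviation is not square integrable** — by the L² flux Liouville of this line
(`eq_farField_of_constSpeed_of_sq_integrable_axial`): a `C¹` divergence-free constant-speed field with
`‖v − e₃‖² ∈ L¹` is the constant `e₃`, and this one is not. [folklore] -/
theorem not_integrable_norm_sub_sq :
    ¬ Integrable (fun x => ‖field x - EuclideanSpace.single (2 : Fin 3) (1 : ℝ)‖ ^ 2) volume := by
  intro hint
  refine field_ne_const (eq_farField_of_constSpeed_of_sq_integrable_axial (contDiff_field (n := 1))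
    isDivFree_field norm_field ?_ (by simp) (by simp) (by simp) hint)
  simp

/-- **PACKAGED STATEMENT (the soft residue class of K1b is non-empty).**  There is a field on `ℝ³` which is real
analytic, smooth, divergence free, of constant speed `1`, converges to `e₃` at infinity, is NOT constant, and whose
deviation from `e₃` is NOT square integrable.  Hence «constant speed + divergence free + analytic + far field» admits
no Liouville theorem: a proof of K1b (`stub_noAnalyticExtremal`) must use the extremality (KKT / Euler–Lagrange)
information.  (Bounded gradient and `D¹v, D²v ∈ L²` hold for this field too — `‖Dv‖, ‖D²v‖ = O(1/Q)` — but are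
not formalised here.) [folklore] -/
theorem exists_constantSpeed_divFree_analytic_nonconstant :
    ∃ w : EuclideanSpace ℝ (Fin 3) → EuclideanSpace ℝ (Fin 3), AnalyticOnNhd ℝ w univ ∧ ContDiff ℝ (⊤ : ℕ∞) w ∧ VectorCalculus.IsDivFree w ∧
      (∀ x, ‖w x‖ = 1) ∧ Tendsto w (cocompact (EuclideanSpace ℝ (Fin 3))) (𝓝 (EuclideanSpace.single (2 : Fin 3) (1 : ℝ))) ∧
      (¬ ∀ x, w x = EuclideanSpace.single (2 : Fin 3) (1 : ℝ)) ∧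
      ¬ Integrable (fun x => ‖w x - EuclideanSpace.single (2 : Fin 3) (1 : ℝ)‖ ^ 2) volume :=
  ⟨field, analyticOnNhd_field, contDiff_field, isDivFree_field, norm_field, tendsto_field_cocompact,
    field_ne_const, not_integrable_norm_sub_sq⟩


end ConstantSpeedExample

end ExtremiserLiouville

end Summit.NavierStokesRegularity.NavierStokesRegularity.Theorems

end
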